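import Mathlib.Analysis.SpecialFunctions.Pow.Real
import Mathlib.Analysis.SpecificLimits.Basic
import HarnessLib

/-!
# The dyadic sum of window bounds near a wall corner

Topic `Probability/Percolation`.  Support file (proofs, no named fact) for the named fact
`SchrammSmirnov2011_thm_1_7` (Prop. 4.1, "Bays and beaches"): the bookkeeping behind the
two-factor bound of `CollarWindowTwoFactor.lean`.  Near a corner of a rectilinear wall the windows
of width `m` at dyadic distance `2^k m` from the corner (about `2^k` of them) are clean only to
radius `≍ 2^k m`; their bad-pattern probability is bounded by the half-plane three-arm bound at
that radius, `≲ (m / 2^k m)^{1+α}`, times the annulus factor `(2^k m / S)^ε` out to the far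
distance `S`.  The resulting dyadic sum is a convergent geometric series as soon as `ε < α`:
`Σ_k 2^k (2^{-k})^{1+α} (2^k m/S)^ε · B ≤ B (m/S)^ε / (1 - 2^{-(α-ε)})` (`corner_window_sum`), which
tends to `0` with `m/S` — so each corner costs `O((m/S)^ε)`.

## References

* O. Schramm, S. Smirnov, *On the scaling limits of planar percolation*, Ann. Probab. 39 (2011)
  1768–1814, arXiv:1101.5820, §4, proof of Prop. 4.1 with Lemma 6.2. [SchrammSmirnov2011]
-/

noncomputable section

open Finset Real

namespace Literature.Probability.Percolation

/-- The dyadic weights collapse to a geometric sequence: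
`2^k · (2^k)⁻¹^{1+α} · (2^k)^ε = (2^{-(α-ε)})^k`. [folklore] -/
theorem dyadic_weight_eq (α ε : ℝ) (k : ℕ) :
    (2 : ℝ) ^ k * ((2 : ℝ) ^ k)⁻¹ ^ (1 + α) * ((2 : ℝ) ^ k) ^ ε = ((2 : ℝ) ^ (-(α - ε))) ^ k := by
  have h2 : (0 : ℝ) < 2 := by norm_num
  have h2k : (0 : ℝ) < (2 : ℝ) ^ k := by positivity
  -- write everything as real powers of `2`
  rw [← Real.rpow_natCast (2 : ℝ) k] at h2k ⊢
  rw [Real.inv_rpow (by positivity), ← Real.rpow_neg (by positivity), ← Real.rpow_mul h2.le,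
    ← Real.rpow_mul h2.le, ← Real.rpow_add h2, ← Real.rpow_add h2, ← Real.rpow_natCast, ← Real.rpow_mul h2.le]
  congr 1
  ring

/-- **The corner sum.**  If `ε < α` and the level-`k` contribution is at most
`B · 2^k · (2^k)⁻¹^{1+α} · (2^k m / S)^ε`, the total over the levels `k < n` is at most
`B (m/S)^ε / (1 - 2^{-(α-ε)})`. [cite: SchrammSmirnov2011, §4, proof of Prop. 4.1 (the number of bays is bounded off the small-bay event)] -/
theorem corner_window_sum {α ε m S B : ℝ} (hεα : ε < α) (hm : 0 ≤ m) (hS : 0 < S) (hB : 0 ≤ B)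
    (n : ℕ) (p : ℕ → ℝ)
    (hp : ∀ k < n, p k ≤ B * ((2 : ℝ) ^ k * ((2 : ℝ) ^ k)⁻¹ ^ (1 + α) * ((2 : ℝ) ^ k * m / S) ^ ε)) :
    ∑ k ∈ range n, p k ≤ B * (m / S) ^ ε / (1 - (2 : ℝ) ^ (-(α - ε))) := by
  set q : ℝ := (2 : ℝ) ^ (-(α - ε)) with hq
  have hq0 : 0 < q := Real.rpow_pos_of_pos (by norm_num) _
  have hq1 : q < 1 := Real.rpow_lt_one_of_one_lt_of_neg (by norm_num) (by linarith)
  -- each level is `B (m/S)^ε q^k`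
  have hterm : ∀ k, B * ((2 : ℝ) ^ k * ((2 : ℝ) ^ k)⁻¹ ^ (1 + α) * ((2 : ℝ) ^ k * m / S) ^ ε) = B * (m / S) ^ ε * q ^ k := by
    intro k
    have hmS : 0 ≤ m / S := div_nonneg hm hS.le
    rw [show (2 : ℝ) ^ k * m / S = (2 : ℝ) ^ k * (m / S) by ring, Real.mul_rpow (by positivity) hmS,
      show (2 : ℝ) ^ k * ((2 : ℝ) ^ k)⁻¹ ^ (1 + α) * (((2 : ℝ) ^ k) ^ ε * (m / S) ^ ε) =
        ((2 : ℝ) ^ k * ((2 : ℝ) ^ k)⁻¹ ^ (1 + α) * ((2 : ℝ) ^ k) ^ ε) * (m / S) ^ ε by ring,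
      dyadic_weight_eq, ← hq]
    ring
  calc ∑ k ∈ range n, p k ≤ ∑ k ∈ range n, B * (m / S) ^ ε * q ^ k :=
        Finset.sum_le_sum fun k hk => (hp k (Finset.mem_range.1 hk)).trans (le_of_eq (hterm k))
    _ = B * (m / S) ^ ε * ∑ k ∈ range n, q ^ k := by rw [Finset.mul_sum]
    _ ≤ B * (m / S) ^ ε * (1 - q)⁻¹ := by
        refine mul_le_mul_of_nonneg_left ?_ (by positivity)
        rw [geom_sum_eq hq1.ne, div_eq_mul_inv]
        have h1 : 0 < 1 - q := by linarith
        have h2 : (q ^ n - 1) * (q - 1)⁻¹ = (1 - q ^ n) * (1 - q)⁻¹ := by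
          rw [show q - 1 = -(1 - q) by ring, inv_neg]; ring
        rw [h2]
        have : 1 - q ^ n ≤ 1 := by linarith [pow_nonneg hq0.le n]
        exact (mul_le_mul_of_nonneg_right this (inv_nonneg.2 h1.le)).trans (by rw [one_mul])
    _ = B * (m / S) ^ ε / (1 - q) := (div_eq_mul_inv _ _).symm

end Literature.Probability.Percolation

end
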